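import Summits.ValiantsHypothesis.ValiantsHypothesis.Theorems.DivisionGapPerDivisionHardStubAtomicTop
import Summits.ValiantsHypothesis.ValiantsHypothesis.Theorems.DivisionGapPerDivisionHardStubSparseRigidCount
import Summits.ValiantsHypothesis.ValiantsHypothesis.Theorems.DivisionGapDefs

/-!
# Crux `DivisionGap.PerDivisionHard` (stmt-ValiantsHypothesis-5065), line `pair-descent-jss-endpoint` —
stub `stub_pairMono`: K2 for an atomic expression whose separating atoms are monomials

`stub_pairMono`: at a face `G` containing a perfect matching, an atomic expression
`h = Σ_{l ∈ L} a_l · x^{C_l} · ∏_{β ∈ I} F_β^{μ_l(β)}` over atoms with at most two monomials (of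
equal degree within the atom), all monomials of `h` of the same degree, every binomial atom's two
monomials differing somewhere OFF `G` (H1), any two terms differing only on MONOMIAL atoms, and
every difference vector
`V_{l₁l₂} = C_{l₁} - C_{l₂} + Σ_β (μ_{l₁} β - μ_{l₂} β) · (Σ_{f ∈ supp F_β} f)` either `0` or
nonzero somewhere off `G` (H3), admits a weight cutting out `G` whose top fibre has a single
`G`-part.

Proof.  Take the generic digit weight `w = genericWeight G B` (`W = B^{n²}` on `G`,
`W - B^{rank e}` off `G`) with a radix `B` exceeding the degree of `h` and of every atom; it cuts
out `G` (`cutsOut_genericWeight`).  Two monomials of the same degree in the top-`w` fibre of a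
polynomial of degree `< B` agree off `G` (`weight_add_offDigitSum`, `eq_offG_of_offDigitSum_eq`).
(1) Hence every atom is STRICTLY DECIDED: its top fibre is a single monomial `b_β` (two of them
would agree off `G`, contradicting H1).  (2) By `stub_atomicTop` every monomial of the top fibre
of `h` is `C_l + Σ_β μ_l(β) • b_β` for some term `l`.  (3) Two such monomials have the same weight
and degree, so they agree off `G`; their difference is the vector `V_{l₁l₂}` of H3 (on an atom with
`μ_{l₁} β ≠ μ_{l₂} β` the support is the singleton `{b_β}`), so by H3 they are equal.  The fibre
is thus a single monomial `m₀` (or empty), and `u = m₀|_G`. [folklore]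
-/

noncomputable section

-- `Summit.ValiantsHypothesis.ValiantsHypothesis.…` is the tree's mandated single-conjunct layout
-- (Sub = Summit), so the duplicated namespace component is intended.
set_option linter.dupNamespace false

namespace Summit.ValiantsHypothesis.ValiantsHypothesis.Theorems.DivisionGapPerDivisionHard

open MvPolynomial Literature.Computability.AlgebraicComplexity
open Summit.ValiantsHypothesis.ValiantsHypothesis.Theorems.ZeroOneTransfer.Negative
open scoped NNReal

/-! ### The top fibre of the generic weight, digits below the radix -/

/-- Two monomials of the same degree in the top fibre of `topComponent (genericWeight G B) p`,
all of whose entries are `< B`, agree off `G` (weight plus off-`G` digit sum is `W · deg`,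
`weight_add_offDigitSum`; base-`B` digit vectors are determined by their value,
`eq_offG_of_offDigitSum_eq`). [folklore] -/
theorem eq_offG_of_mem_support_topComponent_of_lt {n : ℕ} (G : Finset (Fin n × Fin n)) {B : ℕ}
    (hB : 0 < B) {p : MvPolynomial (Fin n × Fin n) ℝ≥0} {m₁ m₂ : (Fin n × Fin n) →₀ ℕ}
    (hm₁ : m₁ ∈ (topComponent (genericWeight G B) p).support)
    (hm₂ : m₂ ∈ (topComponent (genericWeight G B) p).support)
    (h₁ : ∀ e, m₁ e < B) (h₂ : ∀ e, m₂ e < B) (hdeg : m₁.degree = m₂.degree) :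
    ∀ e ∉ G, m₁ e = m₂ e := by
  have hw₁ := weight_eq_of_mem_support_topComponent _ p hm₁
  have hw₂ := weight_eq_of_mem_support_topComponent _ p hm₂
  have e₁ := weight_add_offDigitSum G hB m₁
  have e₂ := weight_add_offDigitSum G hB m₂
  refine eq_offG_of_offDigitSum_eq G h₁ h₂ ?_
  rw [hdeg] at e₁
  omega

/-! ### The stub -/

/-- **`stub_pairMono`.**  At a face `G` containing a perfect matching, for an atomic expression
over atoms with `≤ 2` monomials of equal degree, all monomials of `h` of equal degree, every
binomial atom's two monomials differing off `G` (H1), any two terms differing only on monomial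
atoms, and every difference vector `V_{l₁l₂}` either `0` or nonzero off `G` (H3), some weight cuts
out `G` with a single `G`-part: the generic digit weight decides every binomial atom strictly
(H1), so by `stub_atomicTop` the fibre monomials are `C_l + Σ_β μ_l(β) • b_β`, pairwise differing
by the vectors `V` of H3, hence all equal. [folklore] -/
theorem stub_pairMono :
    ∀ (n : ℕ) (G : Finset (Fin n × Fin n)) (ι κ : Type) (I : Finset ι) (L : Finset κ)
      (F : ι → MvPolynomial (Fin n × Fin n) ℝ≥0) (a : κ → ℝ≥0) (C : κ → (Fin n × Fin n) →₀ ℕ)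
      (μ : κ → ι → ℕ),
      (∃ σ : Equiv.Perm (Fin n), ∀ i, (σ i, i) ∈ G) →
      (∀ β ∈ I, F β ≠ 0 ∧ (F β).support.card ≤ 2 ∧
        ∀ f ∈ (F β).support, ∀ f' ∈ (F β).support, f.degree = f'.degree) →
      (∀ l ∈ L, a l ≠ 0) →
      (∀ m₁ ∈ (∑ l ∈ L, a l • (monomial (C l) (1 : ℝ≥0) * ∏ β ∈ I, F β ^ μ l β)).support,
        ∀ m₂ ∈ (∑ l ∈ L, a l • (monomial (C l) (1 : ℝ≥0) * ∏ β ∈ I, F β ^ μ l β)).support,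
        m₁.degree = m₂.degree) →
      (∀ β ∈ I, ∀ f ∈ (F β).support, ∀ f' ∈ (F β).support, f ≠ f' → ∃ e ∉ G, f e ≠ f' e) →
      (∀ l₁ ∈ L, ∀ l₂ ∈ L, ∀ β ∈ I, μ l₁ β ≠ μ l₂ β → (F β).support.card = 1) →
      (∀ l₁ ∈ L, ∀ l₂ ∈ L,
        (∀ e, (C l₁ e : ℤ) - C l₂ e +
            ∑ β ∈ I, ((μ l₁ β : ℤ) - μ l₂ β) * ∑ f ∈ (F β).support, (f e : ℤ) = 0) ∨
        ∃ e ∉ G, (C l₁ e : ℤ) - C l₂ e +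
            ∑ β ∈ I, ((μ l₁ β : ℤ) - μ l₂ β) * ∑ f ∈ (F β).support, (f e : ℤ) ≠ 0) →
      ∃ w : Fin n × Fin n → ℕ, CutsOut w G ∧ ∃ u : (Fin n × Fin n) →₀ ℕ,
        HasSingleGPart G w
          (∑ l ∈ L, a l • (monomial (C l) (1 : ℝ≥0) * ∏ β ∈ I, F β ^ μ l β)) u := by
  intro n G ι κ I L F a C μ hσ hF _ha hdeg hH1 hmono hH3
  classical
  obtain ⟨σ₀, hσ₀⟩ := hσ
  set h := ∑ l ∈ L, a l • (monomial (C l) (1 : ℝ≥0) * ∏ β ∈ I, F β ^ μ l β) with hh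
  -- a radix exceeding every relevant exponent
  set B := h.totalDegree + ∑ β ∈ I, (F β).totalDegree + 1 with hB
  have hB0 : 0 < B := Nat.succ_pos _
  have hlth : ∀ m ∈ h.support, ∀ e, m e < B := fun m hm e =>
    Nat.lt_succ_of_le (((Finsupp.le_degree e m).trans (le_totalDegree hm)).trans
      (Nat.le_add_right _ _))
  have hltF : ∀ β ∈ I, ∀ f ∈ (F β).support, ∀ e, f e < B := fun β hβ f hf e =>
    Nat.lt_succ_of_le (((Finsupp.le_degree e f).trans (le_totalDegree hf)).trans
      ((Finset.single_le_sum (f := fun β => (F β).totalDegree) (fun _ _ => Nat.zero_le _)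
        hβ).trans (Nat.le_add_left _ _)))
  set w := genericWeight G B with hw
  -- (1) every atom is strictly decided: its top fibre is a single monomial `b β`
  have hdec : ∀ β ∈ I, ∃ b : (Fin n × Fin n) →₀ ℕ, (topComponent w (F β)).support = {b} := by
    intro β hβ
    obtain ⟨b, hb⟩ := support_nonempty.mpr (topComponent_ne_zero w (hF β hβ).1)
    refine ⟨b, Finset.eq_singleton_iff_unique_mem.2 ⟨hb, fun f hf => ?_⟩⟩
    by_contra hne
    have hfs := support_topComponent_subset w _ hf
    have hbs := support_topComponent_subset w _ hb
    obtain ⟨e, heG, hne'⟩ := hH1 β hβ f hfs b hbs hne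
    exact hne' (eq_offG_of_mem_support_topComponent_of_lt G hB0 hf hb (hltF β hβ f hfs)
      (hltF β hβ b hbs) ((hF β hβ).2.2 f hfs b hbs) e heG)
  choose! b hb using hdec
  -- (2) the fibre monomials are `C l + Σ_β μ l β • b β`
  have hfib : ∀ m ∈ (topComponent w h).support, ∃ l ∈ L, m = C l + ∑ β ∈ I, μ l β • b β := by
    intro m hm
    obtain ⟨l, hl, f, hf, rfl⟩ := stub_atomicTop n ι κ I L F a C μ w m hm
    refine ⟨l, hl, ?_⟩
    congr 1
    refine Finset.sum_congr rfl fun β hβ => ?_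
    have hfj : ∀ j ∈ Finset.range (μ l β), f β j = b β := fun j hj => by
      have := hf β hβ j (Finset.mem_range.1 hj)
      rw [hb β hβ] at this
      exact Finset.mem_singleton.1 this
    rw [Finset.sum_congr rfl hfj, Finset.sum_const, Finset.card_range]
  -- (3) the fibre has at most one element
  have huniq : ∀ m₁ ∈ (topComponent w h).support, ∀ m₂ ∈ (topComponent w h).support,
      m₁ = m₂ := by
    intro m₁ hm₁ m₂ hm₂
    have hs₁ := support_topComponent_subset w h hm₁
    have hs₂ := support_topComponent_subset w h hm₂
    have hoff := eq_offG_of_mem_support_topComponent_of_lt G hB0 hm₁ hm₂ (hlth m₁ hs₁)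
      (hlth m₂ hs₂) (hdeg m₁ hs₁ m₂ hs₂)
    obtain ⟨l₁, hl₁, rfl⟩ := hfib m₁ hm₁
    obtain ⟨l₂, hl₂, rfl⟩ := hfib m₂ hm₂
    -- the vector `V` of H3 is the difference of the two fibre monomials
    have hV : ∀ e, (C l₁ e : ℤ) - C l₂ e +
        ∑ β ∈ I, ((μ l₁ β : ℤ) - μ l₂ β) * ∑ f ∈ (F β).support, (f e : ℤ) =
        ((C l₁ + ∑ β ∈ I, μ l₁ β • b β) e : ℤ) - ((C l₂ + ∑ β ∈ I, μ l₂ β • b β) e : ℤ) := by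
      intro e
      have key : ∀ β ∈ I, ((μ l₁ β : ℤ) - μ l₂ β) * ∑ f ∈ (F β).support, (f e : ℤ) =
          ((μ l₁ β : ℤ) - μ l₂ β) * b β e := by
        intro β hβ
        by_cases hμ : μ l₁ β = μ l₂ β
        · rw [hμ, sub_self, zero_mul, zero_mul]
        · obtain ⟨b', hb'⟩ := Finset.card_eq_one.1 (hmono l₁ hl₁ l₂ hl₂ β hβ hμ)
          have hbβ : b β ∈ (F β).support :=
            support_topComponent_subset w _ (by rw [hb β hβ]; exact Finset.mem_singleton_self _)
          rw [hb'] at hbβ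
          rw [hb', Finset.sum_singleton, Finset.mem_singleton.1 hbβ]
      rw [Finset.sum_congr rfl key]
      simp only [Finsupp.add_apply, Finsupp.finsetSum_apply, Finsupp.smul_apply, smul_eq_mul]
      push_cast
      simp only [sub_mul, Finset.sum_sub_distrib]
      ring
    rcases hH3 l₁ hl₁ l₂ hl₂ with h0 | ⟨e, heG, hne⟩
    · exact Finsupp.ext fun e => by
        have := h0 e
        rw [hV e] at this
        exact_mod_cast sub_eq_zero.mp this
    · exact absurd ((hV e).trans (sub_eq_zero.mpr (by rw [hoff e heG]))) hne
  -- conclusion: `u` is the `G`-part of the unique fibre monomial (if any)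
  refine ⟨w, cutsOut_genericWeight G hB0 σ₀ hσ₀, ?_⟩
  by_cases hne : (topComponent w h).support.Nonempty
  · obtain ⟨m₀, hm₀⟩ := hne
    refine ⟨m₀.filter (· ∈ G), fun e he => ?_, fun m' hm' e he => ?_⟩
    · rw [Finsupp.support_filter] at he
      exact (Finset.mem_filter.mp he).2
    · rw [huniq m' hm' m₀ hm₀, Finsupp.filter_apply_pos _ _ he]
  · exact ⟨0, by simp, fun m' hm' => absurd ⟨m', hm'⟩ hne⟩

end Summit.ValiantsHypothesis.ValiantsHypothesis.Theorems.DivisionGapPerDivisionHard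

end
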